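import Summits.AtomisticToContinuum.Crystallization.Theorems.FrustratedLawDichotomyStrainedPatchHomEntryLeafHTA2QCellG70V2

/-!
# v3 ANCHOR CELL (T0) `cG70 × wG70` (0.70 t_b, FULL 2⁻⁹ entry cube (k₆ = 6)), part 3: far sum, ONE inner leaf, END TO END in the v3 currency
# (27623 `(H) HomFloor (1/625)`, hcp half; pre-staged by hand-1 g37, LANDED by hand-1 g38 on critic GO row 1436 (E) / 1437 (E) «T0 anchors»)

Kernel facts + assembly; 0 sorry; standard axioms.  `--supports stmt-AtomisticToContinuum-27623`.
-/

namespace Summit.AtomisticToContinuum.Crystallization.Theorems.FrustratedLawDichotomyStrainedPatchHomEntryLeafHT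

open Literature.Analysis.ValidatedNumerics.Numerics
open Summit.AtomisticToContinuum.Crystallization.Theorems.FrustratedLawDichotomyStrainedPatchHomCertTree (CertTree treeOK)
open Summit.AtomisticToContinuum.Crystallization.Theorems.FrustratedLawDichotomyStrainedPatchHomEntryTable (muRec)
open Summit.AtomisticToContinuum.Crystallization.Theorems.FrustratedLawDichotomyStrainedPatchHomEntryFitHcpCentred (entryLeafOKHQDCRS)
open Summit.AtomisticToContinuum.Crystallization.Theorems.FrustratedLawDichotomyStrainedPatchHomSlopeLJ
open Summit.AtomisticToContinuum.Crystallization.Theorems.FrustratedLawDichotomyStrainedPatchHomSlopeLJAffine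
open Summit.AtomisticToContinuum.Crystallization.Theorems.FrustratedLawDichotomyStrainedPatchHomSlopeLJAffine2Kit
open Summit.AtomisticToContinuum.Crystallization.Theorems.FrustratedLawDichotomyStrainedPatchHomSlopeLJAffine2KitS (rem3LJS)

set_option maxRecDepth 100000 in
set_option maxHeartbeats 4000000 in
/-- ★ KERNEL: `GnG70V + far₁ + far₂ ≤ pG70V.Gs`. -/
theorem farG70V : GnG70V + htGsNA cG70 wG70 JG70 (htFar1U cG70 wG70) + htGsNA cG70 wG70 JG70 (htFar2U cG70 wG70) ≤ pG70V.Gs := by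
  decide +kernel

/-- ★★★ The sharp-remainder certificate side of the cell holds. [assembly] -/
theorem htCertSideA2QS_G70V : htCertSideA2QS pG70V QG70 GnG70V JG70 cG70 wG70 = true :=
  htCertSideA2QS_of_parts restG70V qG70_0 qG70_1 qG70_2 linG70V farG70V

set_option maxRecDepth 100000 in
set_option maxHeartbeats 4000000 in
/-- ★ KERNEL: ONE inner hull leaf of the squared-test inner verdict closes the confined box `htWr pG70V`. -/
theorem treeA2QS_G70V : treeOK (hullInner (entryLeafOKHQDCRS muRec qX90c) JG70 cG70) CertTree.leaf cG70 (htWr pG70V cG70 wG70) = true := by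
  decide +kernel

/-- ★★★ **THE CELL CLOSES END TO END IN THE v3 CURRENCY** (one inner leaf). [assembly] -/
theorem entryLeafOKHT4A2QSQDCRS_G70V : entryLeafOKHT4A2QSQDCRS muRec qX90c pG70V QG70 GnG70V JG70 CertTree.leaf cG70 wG70 = true :=
  entryLeafOKHT4A2QSQDCRS_of_parts htCertSideA2QS_G70V treeA2QS_G70V

/-- ★ … hence the cell is a one-leaf ∃-tree of the production verdict v3 `entryLeafOKHT4A2QQDCRS3 muRec`. [formal bookkeeping] -/
theorem okS3_G70 : ∃ t : CertTree ((Fin 3 × Fin 3) ⊕ Fin 3), treeOK (entryLeafOKHT4A2QQDCRS3 muRec) t cG70 wG70 = true :=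
  exists_tree_HT4A2QQDCRS3_of_certS3 entryLeafOKHT4A2QSQDCRS_G70V

end Summit.AtomisticToContinuum.Crystallization.Theorems.FrustratedLawDichotomyStrainedPatchHomEntryLeafHT
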